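import Mathlib
import HarnessLib
import Summits.HubbardSuperconductivity.HubbardSuperconductivity.Theorems.KLProgrammeC4aLoopNondegeneracy
import Summits.HubbardSuperconductivity.HubbardSuperconductivity.Theorems.KLProgrammeC4aLoopAlignmentSheets
import Summits.HubbardSuperconductivity.HubbardSuperconductivity.Theorems.KLProgrammeC4aRigidConfigurations

/-!
# Route `KLProgramme` — crux C4a, S3 brick (B2-trans)(b) GEOMETRY, part 6: the PARTICLE–HOLE twins — the pair-difference path IS the pair-sum path at `ϑ − π`
# (`D_{ρ,ϑ,θ} = S_{ρ,ϑ−π,θ}`), so the ph loop's alignment dichotomy / non-degeneracy are parts 3′/5 read at `ϑ − π`: FORWARD (`‖ϑ‖_𝕋` small) or ph-TANGENCY (`‖ϑ − π‖_𝕋` small)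

Cell `gate-hubbard-kl`, seat hubbard-kl-k3c3-p3 g19; helper for stub (C) `stub_twoLeg_curvature` of `KLRegimeEngineV17F2` (stmt-HubbardSuperconductivity-20437), lane hubbard-kl-c4a-1's
S3 plan §24.2/§24.10 (ph class: crossings `partnerBand_ph_at_k/_at_neg_q`, (C) ↦ forward `ϑ = 0`, (T) ↦ `ϑ = π`).  SETTING: `D = D_{ρ,ϑ,θ}(0) = Φ(0,θ) − Φ(ρ,ϑ+θ)` (`pairDiffPath`),
loop point `p = Φ(e,φ+θ)`, ph partner `p − D`; sheet hypothesis `hP : Φ(e,φ+θ) − D = Φ(e′,ψ) + v` (`v` a period of `e_K`; direct sheet `v = 0`); slope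
`ℓ = De_K(Φ(e′,ψ))[∂_sΦ(e,φ+θ)]` (`= +∂_φē` by c4a-1's `hasDerivAt_partnerBand_ph_angle` and `fderiv_frameLevel_add_period`).
* §1 `levelPoint_sub_pi` (`Φ(ρ, x − π) = −Φ(ρ,x)`), **`pairDiffPath_eq_pairSumPath_sub_pi`** (`D_{ρ,ϑ,θ}(t) = S_{ρ,ϑ−π,θ}(t)`), `fderiv_frameLevel_neg_apply` (`De_K(−q) = −De_K(q)`, `e_K` even),
  `abs_fderiv_frameLevel_levelPoint_sub_pi`;
* §2 **`loopAlignment_dichotomy_sheet_ph`** — with part 3's `τ(ℓ, e, e′)`: `‖D + v‖ ≤ msD·τ + |e−e′|/(Dt−2A)` OR `‖D + v − 2Φ(0,φ+θ)‖ ≤ msD·τ + (|e|+|e′|)/(Dt−2A)`;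
* §3 **`loop_nondegeneracy_directSheet_ph`** (`v = 0`): FORWARD `(2u_min/π)‖ϑ‖_𝕋 ≤ msD·τ + |e−e′|/(Dt−2A)` OR ph-TANGENCY corner
  `‖Φ(0,θ) − Φ(ρ,ϑ−π+θ)‖² ≤ 6π²(2A + |ρ| + Kc(msD·τ + (|e|+|e′|)/(Dt−2A))/2)/(−μ−A−|ρ|)` with `(2u_min/π)‖ϑ − π‖_𝕋 ≤ ‖Φ(0,θ) − Φ(ρ,ϑ−π+θ)‖` (`torusDist_sub_pi_le_norm_chord_ph`).
Nothing about the model's sizes; nothing asserts superconductivity.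
References: BGM 2003 §7.1 Lemma 7.1 (A1.9) [cite: BenfattoGiulianiMastropietro2003]; FST II CPAM 51 (1998) §3, App. B [cite: FeldmanSalmhoferTrubowitz1998].
-/

noncomputable section

namespace Summit.HubbardSuperconductivity.HubbardSuperconductivity.Theorems.C4a

set_option linter.dupNamespace false -- summit = problem name (single-conjunct summit), D-0017

open Real Set
open Literature.MathematicalPhysics.QuantumLattice Literature.MathematicalPhysics.QuantumLattice.BandSectorCounting
open Literature.MathematicalPhysics.QuantumLattice.FermiRG
open Summit.HubbardSuperconductivity.HubbardSuperconductivity.Theorems.KLRegimeSplit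
open Summit.HubbardSuperconductivity.HubbardSuperconductivity.Theorems.DispersionFlow
open Summit.HubbardSuperconductivity.HubbardSuperconductivity.Theorems.PerturbedFermiCurve

/-! ## §1 Half-turn identities -/

/-- `Φ(ρ, x − π) = −Φ(ρ, x)`. -/
theorem levelPoint_sub_pi (μ : ℝ) (K : TrigPolyC4v) (ρ x : ℝ) : levelPoint μ K ρ (x - π) = -levelPoint μ K ρ x := by
  have h := levelPoint_add_pi μ K ρ (x - π)
  rw [sub_add_cancel] at h
  rw [h, neg_neg]

/-- **The pair-difference path is the pair-sum path at `ϑ − π`**: `Φ(0,θ+t) − Φ(ρ,ϑ+θ+t) = Φ(0,θ+t) + Φ(ρ,(ϑ−π)+θ+t)`. -/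
theorem pairDiffPath_eq_pairSumPath_sub_pi (μ : ℝ) (K : TrigPolyC4v) (ρ ϑ θ t : ℝ) :
    pairDiffPath μ K ρ ϑ θ t = pairSumPath μ K ρ (ϑ - π) θ t := by
  have e : levelPoint μ K ρ (ϑ - π + θ + t) = -levelPoint μ K ρ (ϑ + θ + t) := by
    rw [show ϑ - π + θ + t = (ϑ + θ + t) - π by ring, levelPoint_sub_pi]
  show levelPoint μ K 0 (θ + t) - levelPoint μ K ρ (ϑ + θ + t) = levelPoint μ K 0 (θ + t) + levelPoint μ K ρ (ϑ - π + θ + t)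
  rw [e, sub_eq_add_neg]

/-- **`e_K` is even, so `De_K(−q)[w] = −De_K(q)[w]`.** -/
theorem fderiv_frameLevel_neg_apply (μ : ℝ) (K : TrigPolyC4v) (q w : Momentum) :
    fderiv ℝ (frameLevel μ K) (-q) w = -fderiv ℝ (frameLevel μ K) q w := by
  have hfun : (frameLevel μ K) ∘ (fun x : Momentum => -x) = frameLevel μ K := funext (frameLevel_neg μ K)
  have hdiff : DifferentiableAt ℝ (frameLevel μ K) (-q) := ((EngineV8.contDiff_frameLevel μ K (n := 1)).differentiable one_ne_zero) _
  have hneg : HasFDerivAt (fun x : Momentum => -x) (-(ContinuousLinearMap.id ℝ Momentum)) q := (hasFDerivAt_id q).neg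
  have hcomp := hdiff.hasFDerivAt.comp q hneg
  rw [hfun] at hcomp
  rw [hcomp.fderiv]
  simp

/-- `|De_K(Φ(ρ, ψ − π))[w]| = |De_K(Φ(ρ, ψ))[w]|`. -/
theorem abs_fderiv_frameLevel_levelPoint_sub_pi (μ : ℝ) (K : TrigPolyC4v) (ρ ψ : ℝ) (w : Momentum) :
    |fderiv ℝ (frameLevel μ K) (levelPoint μ K ρ (ψ - π)) w| = |fderiv ℝ (frameLevel μ K) (levelPoint μ K ρ ψ) w| := by
  rw [levelPoint_sub_pi, fderiv_frameLevel_neg_apply, abs_neg]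

/-- `‖(ϑ − π) − π‖_𝕋 = ‖ϑ‖_𝕋`. -/
theorem torusDist_sub_pi_sub_pi (ϑ : ℝ) : torusDist (ϑ - π - π) = torusDist ϑ := by
  rw [show ϑ - π - π = ϑ + ((-1 : ℤ) : ℝ) * (2 * π) by push_cast; ring, torusDist_add_int_mul_two_pi]

section Sizes

variable {K : TrigPolyC4v} {A : ℝ} (hA : ∀ p : Momentum, ∀ j ≤ 2, ‖iteratedFDeriv ℝ j (frameShift K) p‖ ≤ A) (hA20 : A ≤ 1 / 20)
  (hd : klCurveD ≤ (bandBounds (show (-4 : ℝ) < -1.1 by norm_num) (show (-1.1 : ℝ) ≤ -0.1 by norm_num)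
    (show (-0.1 : ℝ) < 0 by norm_num)).Dtmin - 2 * A)
  {μ r : ℝ} (hr : 0 < r) (hlo : (-1.1 : ℝ) < μ - r - A) (hhi : μ + r + A < -0.1)
  {A₃ A₄ : ℝ} (hA₃ : ∀ p : Momentum, ‖iteratedFDeriv ℝ 3 (frameShift K) p‖ ≤ A₃)
  (hA₄ : ∀ p : Momentum, ‖iteratedFDeriv ℝ 4 (frameShift K) p‖ ≤ A₄)
include hA hA20 hd hr hlo hhi hA₃ hA₄

omit hA hA20 hd hr hlo hhi hA₃ hA₄ in
/-- **Sheet hypothesis conversion ph → pp**: `Φ(e,φ+θ) − D = Φ(e′,ψ) + v` iff `S_{ρ,ϑ−π,θ}(0) − Φ(e,φ+θ) = Φ(e′,ψ−π) + (−v)`. -/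
theorem ph_sheet_to_pp {v : Momentum} {ρ e e' : ℝ} {ϑ θ φ ψ : ℝ}
    (hP : levelPoint μ K e (φ + θ) - pairDiffPath μ K ρ ϑ θ 0 = levelPoint μ K e' ψ + v) :
    pairSumPath μ K ρ (ϑ - π) θ 0 - levelPoint μ K e (φ + θ) = levelPoint μ K e' (ψ - π) + -v := by
  rw [← pairDiffPath_eq_pairSumPath_sub_pi, levelPoint_sub_pi]
  have h : pairDiffPath μ K ρ ϑ θ 0 = levelPoint μ K e (φ + θ) - (levelPoint μ K e' ψ + v) := by rw [← hP]; abel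
  rw [h]; abel

/-! ## §2 The ph alignment dichotomy on a sheet -/

omit hr in
/-- **PH ALIGNMENT DICHOTOMY ON THE SHEET `v`**: under `GeomConstants (frameLevel μ K) Kc r₀ g₀ w`, for the ph loop point `Φ(e,φ+θ)` (`|e| < r`, `|e| < r₀`) with partner
`Φ(e,φ+θ) − D = Φ(e′,ψ) + v` (`|e′| < r`, `v` a period of `e_K`), `ℓ = De_K(Φ(e′,ψ))[∂_sΦ(e,φ+θ)]`, `τ = ((π/2)|ℓ|/((Dt−2A)u_min) + πKc|e′−e|/(Dt−2A)²)/c_K`: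
EITHER `‖D + v‖ ≤ msD·τ + |e − e′|/(Dt−2A)` (forward-type) OR `‖D + v − 2Φ(0,φ+θ)‖ ≤ msD·τ + (|e|+|e′|)/(Dt−2A)` (ph caustic `D ∈ 2·FS − v`).
[cite: BenfattoGiulianiMastropietro2003, §7.1 Lemma 7.1 (A1.9)] -/
theorem loopAlignment_dichotomy_sheet_ph {Kc r₀ g₀ w : ℝ} (hG : GeomConstants (frameLevel μ K) Kc r₀ g₀ w) {v : Momentum}
    {e e' : ℝ} (he : |e| < r) (he' : |e'| < r) (he₀ : |e| < r₀) {ρ ϑ θ φ ψ : ℝ}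
    (hP : levelPoint μ K e (φ + θ) - pairDiffPath μ K ρ ϑ θ 0 = levelPoint μ K e' ψ + v) :
    ‖pairDiffPath μ K ρ ϑ θ 0 + v‖ ≤
        msD A₃ A₄ 1 *
            ((π / 2 * |fderiv ℝ (frameLevel μ K) (levelPoint μ K e' ψ) (iteratedDeriv 1 (levelPoint μ K e) (φ + θ))| /
                  (((bandBounds (show (-4 : ℝ) < -1.1 by norm_num) (show (-1.1 : ℝ) ≤ -0.1 by norm_num) (show (-0.1 : ℝ) < 0 by norm_num)).Dtmin -
                      2 * A) *
                    (bandBounds (show (-4 : ℝ) < -1.1 by norm_num) (show (-1.1 : ℝ) ≤ -0.1 by norm_num) (show (-0.1 : ℝ) < 0 by norm_num)).umin) +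
                π * Kc * |e' - e| / ((bandBounds (show (-4 : ℝ) < -1.1 by norm_num) (show (-1.1 : ℝ) ≤ -0.1 by norm_num)
                  (show (-0.1 : ℝ) < 0 by norm_num)).Dtmin - 2 * A) ^ 2) /
              ((bandBounds (show (-4 : ℝ) < -1.1 by norm_num) (show (-1.1 : ℝ) ≤ -0.1 by norm_num) (show (-0.1 : ℝ) < 0 by norm_num)).umin * w /
                (4 + 2 * A))) +
          |e - e'| / ((bandBounds (show (-4 : ℝ) < -1.1 by norm_num) (show (-1.1 : ℝ) ≤ -0.1 by norm_num) (show (-0.1 : ℝ) < 0 by norm_num)).Dtmin - 2 * A) ∨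
      ‖pairDiffPath μ K ρ ϑ θ 0 + v - (2 : ℝ) • levelPoint μ K 0 (φ + θ)‖ ≤
        msD A₃ A₄ 1 *
            ((π / 2 * |fderiv ℝ (frameLevel μ K) (levelPoint μ K e' ψ) (iteratedDeriv 1 (levelPoint μ K e) (φ + θ))| /
                  (((bandBounds (show (-4 : ℝ) < -1.1 by norm_num) (show (-1.1 : ℝ) ≤ -0.1 by norm_num) (show (-0.1 : ℝ) < 0 by norm_num)).Dtmin -
                      2 * A) *
                    (bandBounds (show (-4 : ℝ) < -1.1 by norm_num) (show (-1.1 : ℝ) ≤ -0.1 by norm_num) (show (-0.1 : ℝ) < 0 by norm_num)).umin) +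
                π * Kc * |e' - e| / ((bandBounds (show (-4 : ℝ) < -1.1 by norm_num) (show (-1.1 : ℝ) ≤ -0.1 by norm_num)
                  (show (-0.1 : ℝ) < 0 by norm_num)).Dtmin - 2 * A) ^ 2) /
              ((bandBounds (show (-4 : ℝ) < -1.1 by norm_num) (show (-1.1 : ℝ) ≤ -0.1 by norm_num) (show (-0.1 : ℝ) < 0 by norm_num)).umin * w /
                (4 + 2 * A))) +
          (|e| + |e'|) / ((bandBounds (show (-4 : ℝ) < -1.1 by norm_num) (show (-1.1 : ℝ) ≤ -0.1 by norm_num) (show (-0.1 : ℝ) < 0 by norm_num)).Dtmin - 2 * A) := by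
  have hP' := ph_sheet_to_pp hP
  have h := loopAlignment_dichotomy_sheet hA hA20 hd hlo hhi hA₃ hA₄ hG he he' he₀ hP'
  rw [abs_fderiv_frameLevel_levelPoint_sub_pi, ← pairDiffPath_eq_pairSumPath_sub_pi, sub_neg_eq_add] at h
  exact h

/-! ## §3 The ph non-degeneracy on the direct sheet -/

omit hA20 hd hr hA₃ hA₄ in
/-- **The leg angle from the ph chord**: `(2u_min/π)·‖ϑ − π‖_𝕋 ≤ ‖Φ(0,θ) − Φ(ρ,(ϑ−π)+θ)‖`. -/
theorem torusDist_sub_pi_le_norm_chord_ph {ρ : ℝ} (hρ : |ρ| < r) (ϑ θ : ℝ) :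
    2 * (bandBounds (show (-4 : ℝ) < -1.1 by norm_num) (show (-1.1 : ℝ) ≤ -0.1 by norm_num) (show (-0.1 : ℝ) < 0 by norm_num)).umin / π *
        torusDist (ϑ - π) ≤ ‖levelPoint μ K 0 θ - levelPoint μ K ρ (ϑ - π + θ)‖ :=
  torusDist_le_norm_chord hA hlo hhi hρ (ϑ - π) θ

omit hA20 hd hr hA₃ hA₄ in
/-- **The leg angle from the pair difference** (forward branch): `(2u_min/π)·‖ϑ‖_𝕋 ≤ ‖D_{ρ,ϑ,θ}(0)‖`. -/
theorem torusDist_le_norm_pairDiffPath {ρ : ℝ} (hρ : |ρ| < r) (ϑ θ : ℝ) :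
    2 * (bandBounds (show (-4 : ℝ) < -1.1 by norm_num) (show (-1.1 : ℝ) ≤ -0.1 by norm_num) (show (-0.1 : ℝ) < 0 by norm_num)).umin / π *
        torusDist ϑ ≤ ‖pairDiffPath μ K ρ ϑ θ 0‖ := by
  have h := torusDist_le_norm_chord hA hlo hhi hρ ϑ θ
  simpa only [pairDiffPath, add_zero] using h

/-- **PH NON-DEGENERACY ON THE DIRECT SHEET**: for the ph loop point `Φ(e,φ+θ)` with direct-sheet partner `Φ(e,φ+θ) − D = Φ(e′,ψ)`, `ℓ = De_K(Φ(e′,ψ))[∂_sΦ(e,φ+θ)] = ∂_φē`: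
EITHER (FORWARD) `(2u_min/π)‖ϑ‖_𝕋 ≤ msD·τ + |e−e′|/(Dt−2A)` OR (ph TANGENCY corner, `ϑ ≡ π`)
`‖Φ(0,θ) − Φ(ρ,ϑ−π+θ)‖² ≤ 6π²(2A + |ρ| + Kc(msD·τ + (|e|+|e′|)/(Dt−2A))/2)/(−μ−A−|ρ|)` (then `‖ϑ − π‖_𝕋 ≤ (π/(2u_min))·‖chord‖` by `torusDist_sub_pi_le_norm_chord_ph`).
[cite: BenfattoGiulianiMastropietro2003, §7.1 Lemma 7.1 (A1.9)] -/
theorem loop_nondegeneracy_directSheet_ph {Kc r₀ g₀ w : ℝ} (hG : GeomConstants (frameLevel μ K) Kc r₀ g₀ w) {ρ e e' : ℝ} (hρ : |ρ| < r) (he : |e| < r)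
    (he' : |e'| < r) (he₀ : |e| < r₀) {ϑ θ φ ψ : ℝ} (hP : levelPoint μ K e (φ + θ) - pairDiffPath μ K ρ ϑ θ 0 = levelPoint μ K e' ψ) :
    2 * (bandBounds (show (-4 : ℝ) < -1.1 by norm_num) (show (-1.1 : ℝ) ≤ -0.1 by norm_num) (show (-0.1 : ℝ) < 0 by norm_num)).umin / π *
          torusDist ϑ ≤
        msD A₃ A₄ 1 *
            ((π / 2 * |fderiv ℝ (frameLevel μ K) (levelPoint μ K e' ψ) (iteratedDeriv 1 (levelPoint μ K e) (φ + θ))| /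
                  (((bandBounds (show (-4 : ℝ) < -1.1 by norm_num) (show (-1.1 : ℝ) ≤ -0.1 by norm_num) (show (-0.1 : ℝ) < 0 by norm_num)).Dtmin -
                      2 * A) *
                    (bandBounds (show (-4 : ℝ) < -1.1 by norm_num) (show (-1.1 : ℝ) ≤ -0.1 by norm_num) (show (-0.1 : ℝ) < 0 by norm_num)).umin) +
                π * Kc * |e' - e| / ((bandBounds (show (-4 : ℝ) < -1.1 by norm_num) (show (-1.1 : ℝ) ≤ -0.1 by norm_num)
                  (show (-0.1 : ℝ) < 0 by norm_num)).Dtmin - 2 * A) ^ 2) /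
              ((bandBounds (show (-4 : ℝ) < -1.1 by norm_num) (show (-1.1 : ℝ) ≤ -0.1 by norm_num) (show (-0.1 : ℝ) < 0 by norm_num)).umin * w /
                (4 + 2 * A))) +
          |e - e'| / ((bandBounds (show (-4 : ℝ) < -1.1 by norm_num) (show (-1.1 : ℝ) ≤ -0.1 by norm_num) (show (-0.1 : ℝ) < 0 by norm_num)).Dtmin - 2 * A) ∨
      ‖levelPoint μ K 0 θ - levelPoint μ K ρ (ϑ - π + θ)‖ ^ 2 ≤
        6 * π ^ 2 * (2 * A + |ρ| + Kc *
          (msD A₃ A₄ 1 *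
            ((π / 2 * |fderiv ℝ (frameLevel μ K) (levelPoint μ K e' ψ) (iteratedDeriv 1 (levelPoint μ K e) (φ + θ))| /
                  (((bandBounds (show (-4 : ℝ) < -1.1 by norm_num) (show (-1.1 : ℝ) ≤ -0.1 by norm_num) (show (-0.1 : ℝ) < 0 by norm_num)).Dtmin -
                      2 * A) *
                    (bandBounds (show (-4 : ℝ) < -1.1 by norm_num) (show (-1.1 : ℝ) ≤ -0.1 by norm_num) (show (-0.1 : ℝ) < 0 by norm_num)).umin) +
                π * Kc * |e' - e| / ((bandBounds (show (-4 : ℝ) < -1.1 by norm_num) (show (-1.1 : ℝ) ≤ -0.1 by norm_num)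
                  (show (-0.1 : ℝ) < 0 by norm_num)).Dtmin - 2 * A) ^ 2) /
              ((bandBounds (show (-4 : ℝ) < -1.1 by norm_num) (show (-1.1 : ℝ) ≤ -0.1 by norm_num) (show (-0.1 : ℝ) < 0 by norm_num)).umin * w /
                (4 + 2 * A))) +
            (|e| + |e'|) / ((bandBounds (show (-4 : ℝ) < -1.1 by norm_num) (show (-1.1 : ℝ) ≤ -0.1 by norm_num) (show (-0.1 : ℝ) < 0 by norm_num)).Dtmin -
              2 * A)) / 2) / (-μ - A - |ρ|) := by
  have hP0 : levelPoint μ K e (φ + θ) - pairDiffPath μ K ρ ϑ θ 0 = levelPoint μ K e' ψ + 0 := by rw [add_zero]; exact hP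
  have hP' := ph_sheet_to_pp hP0
  rw [neg_zero, add_zero] at hP'
  have h := loop_nondegeneracy_directSheet hA hA20 hd hr hlo hhi hA₃ hA₄ hG hρ he he' he₀ hP'
  rw [abs_fderiv_frameLevel_levelPoint_sub_pi, torusDist_sub_pi_sub_pi] at h
  exact h

end Sizes

end Summit.HubbardSuperconductivity.HubbardSuperconductivity.Theorems.C4a

end
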